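import Mathlib
import HarnessLib
import Summits.Ventures.LatticeQCDFlow.Scoring.DoeblinPowerBatchMeansCLT
import Summits.Ventures.LatticeQCDFlow.Scoring.RestartJarzynskiWeights
import Summits.Ventures.LatticeQCDFlow.Scoring.RestartTimeAverage

/-!
# THE PAIRED TWO-PROTOCOL TEST OF NE-MCMC: two protocols launched from the SAME equilibrium stream —
# the difference of their Jarzynski weights is ONE bounded observable of ONE restart chain with
# target mean zero, so its studentised time average with the batch-means error bar OF THE
# DIFFERENCE is asymptotically standard normal from every start (no cross-covariance bookkeeping)

HONEST FRAMING: exact (Metropolis-corrected) sampling algorithms for lattice gauge theory;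
figures of merit are autocorrelation/cost numbers at stated couplings and volumes; no
continuum-physics claim.

Venture `LatticeQCDFlow` (cell pub-lqcd), topic `Scoring`; FANOUT row 8 (`s0-cpn-nemc` — S0-D2's
correlated-restart NE-MCMC protocol; Bonanno–Nada–Vadacchino 2024 NAMED ONLY — GEN-25).  NEW WORK of
the cell, not a published result; no definition is introduced; nothing is cited as a fact.
Companion of `Scoring/RestartChainTwoProtocolAgreement.lean` (two INDEPENDENT runs).

THE SITUATION.  In practice two protocol variants (two numbers of non-equilibrium steps, two
interpolations) are evaluated on the SAME thermalised stream: at each restart time the current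
prior configuration `x_t` of the prior chain `κ₀` (leaving `π₀ = Z₀⁻¹ ν₀` invariant, one-step Doeblin
constant `ε > 0`) launches BOTH non-equilibrium evolutions, independently given `x_t` — a path
`ω_t ~ κF(x_t, ·)` of the Crooks pair `(κF, κR, s, e, W)` on `E` and a path `ω'_t ~ κF'(x_t, ·)` of the
Crooks pair `(κF', κR', s', e', W')` on `E'`, both between the SAME `ν₀ → ν₁`.  The triple
`(x_t, ω_t, ω'_t)` is the restart chain of `Scoring/RestartChainAutocorrelation.lean` for the PRODUCT
forward kernel `κF ×ₖ κF' : Kernel Ω (E × E')`: kernel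
`K₂ = prodMkRight (E × E') κ₀ ⊗ₖ prodMkLeft (Ω × (E × E')) (κF ×ₖ κF')`, invariant law
`Π₂ = π₀ ⊗ₘ (κF ×ₖ κF')` (`invariant_restart`), minorised in ONE step by `ε Π₂` (`restart_doeblin`).
The two arms are now CORRELATED (common start), so the two-sample z-statistic of the companion file
is NOT calibrated; but the DIFFERENCE `D(x, ω, ω') = e^{−W(ω)} − e^{−W'(ω')}` is a single bounded
observable of `K₂`, and its target mean VANISHES whatever the two protocols:

* **`integral_fst_restartPair`** / **`integral_snd_restartPair`** — marginalisation:
  `∫ g(ω) dΠ₂ = ∫ g dΠ` and `∫ g(ω') dΠ₂ = ∫ g dΠ'` for bounded measurable `g` (`Π = π₀ ⊗ₘ κF`);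
* **`restart_pairedWeights_mean_zero`** — `∫ D dΠ₂ = Z₁/Z₀ − Z₁/Z₀ = 0`
  (`RestartJarzynskiWeights.restart_jarzynski_mean` twice);
* **`restart_jarzynski_pairedProtocol_agreement_clt`** — with `σ²_D > 0` (ASSUMED), `a_n, b_n → ∞`,
  `N_n = b_n a_n`, for `Y ~ N(0, 1)` and EVERY initial law `μ₀` of the joint restart chain:
  `((√N_n)⁻¹ Σ_{t<N_n} D_t) / √(σ̂²_{D,n}) ⇒ Y`, i.e. the paired z-statistic
  `(Ḡ_N − Ḡ'_N) / (σ̂_{D,n}/√N_n) ⇒ N(0, 1)`, where `σ̂²_{D,n} = a_n b_n · SE²_BM(D)` is the batch-means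
  estimator computed from the DIFFERENCES alone (GEN-20's Doeblin-power studentised CLT
  `Scoring/DoeblinPowerBatchMeansCLT.lean` for the observable `D`);
* **`restart_jarzynski_pairedProtocol_agreement_coverage`** — for every `z > 0`,
  `P_{μ₀} {|z_n| ≤ z} → (gaussianReal 0 1)[−z, z]`.

READING: the paired check needs no estimate of the cross-covariance of the two weight sequences —
batching the differences prices it, together with the prior chain's autocorrelations, automatically;
and it is typically SHARPER than the unpaired one (the common-start fluctuations cancel in `D`).

NOT CLAIMED: any comparison of the paired and unpaired variances (the cancellation is not
quantified here); the `ΔF`-level version; the degenerate case `σ²_D = 0` (which DOES occur when the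
two protocols coincide pathwise); any value of `ε` or `σ²_D`; any number of ours.
-/

noncomputable section

namespace Summit.Ventures.LatticeQCDFlow.Scoring

open MeasureTheory ProbabilityTheory Filter Finset Preorder Set
open Summit.Ventures.LatticeQCDFlow.Exactness Summit.Ventures.LatticeQCDFlow.Exactness.GeneralNCMC
open scoped ENNReal Topology

section Paired

variable {Ω E E' : Type*} [MeasurableSpace Ω] [MeasurableSpace E] [MeasurableSpace E']
  {ν₀ ν₁ : Measure Ω} [IsFiniteMeasure ν₀] [IsFiniteMeasure ν₁]
  {κF κR : Kernel Ω E} [IsMarkovKernel κF] [IsMarkovKernel κR] {s e : E → Ω} {W : E → ℝ}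
  {κF' κR' : Kernel Ω E'} [IsMarkovKernel κF'] [IsMarkovKernel κR'] {s' e' : E' → Ω} {W' : E' → ℝ}
  {κ₀ : Kernel Ω Ω} [IsMarkovKernel κ₀]
  {π₀ : Measure Ω} [IsProbabilityMeasure π₀] {ε : ℝ≥0∞}

omit [IsMarkovKernel κR] [IsMarkovKernel κR'] [IsMarkovKernel κ₀] in
/-- Marginalisation on the first path: for bounded measurable `g : E → ℝ`,
`∫ g(p.2.1) d(π₀ ⊗ₘ (κF ×ₖ κF')) = ∫ g(q.2) d(π₀ ⊗ₘ κF)`. -/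
theorem integral_fst_restartPair {g : E → ℝ} (hg : Measurable g) {C : ℝ} (hC : ∀ ω, |g ω| ≤ C) :
    ∫ p, g p.2.1 ∂(π₀ ⊗ₘ (κF ×ₖ κF')) = ∫ q, g q.2 ∂(π₀ ⊗ₘ κF) := by
  have hi2 : Integrable (fun p : Ω × (E × E') => g p.2.1) (π₀ ⊗ₘ (κF ×ₖ κF')) :=
    Integrable.of_bound (hg.comp (measurable_fst.comp measurable_snd)).aestronglyMeasurable C
      (ae_of_all _ fun p => by simpa only [Real.norm_eq_abs] using hC p.2.1)
  have hi1 : Integrable (fun q : Ω × E => g q.2) (π₀ ⊗ₘ κF) :=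
    Integrable.of_bound (hg.comp measurable_snd).aestronglyMeasurable C
      (ae_of_all _ fun q => by simpa only [Real.norm_eq_abs] using hC q.2)
  rw [Measure.integral_compProd hi2, Measure.integral_compProd hi1]
  refine integral_congr_ae (ae_of_all _ fun x => ?_)
  show ∫ y, g y.1 ∂((κF ×ₖ κF') x) = ∫ y, g y ∂(κF x)
  rw [Kernel.prod_apply]
  have h := integral_prod_mul (μ := κF x) (ν := κF' x) (f := g) (g := fun _ : E' => (1 : ℝ))
  simp only [mul_one, integral_const, smul_eq_mul, probReal_univ] at h
  exact h

omit [IsMarkovKernel κR] [IsMarkovKernel κR'] [IsMarkovKernel κ₀] in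
/-- Marginalisation on the second path: for bounded measurable `g : E' → ℝ`,
`∫ g(p.2.2) d(π₀ ⊗ₘ (κF ×ₖ κF')) = ∫ q, g q.2 ∂(π₀ ⊗ₘ κF')`. -/
theorem integral_snd_restartPair {g : E' → ℝ} (hg : Measurable g) {C : ℝ} (hC : ∀ ω, |g ω| ≤ C) :
    ∫ p, g p.2.2 ∂(π₀ ⊗ₘ (κF ×ₖ κF')) = ∫ q, g q.2 ∂(π₀ ⊗ₘ κF') := by
  have hi2 : Integrable (fun p : Ω × (E × E') => g p.2.2) (π₀ ⊗ₘ (κF ×ₖ κF')) :=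
    Integrable.of_bound (hg.comp (measurable_snd.comp measurable_snd)).aestronglyMeasurable C
      (ae_of_all _ fun p => by simpa only [Real.norm_eq_abs] using hC p.2.2)
  have hi1 : Integrable (fun q : Ω × E' => g q.2) (π₀ ⊗ₘ κF') :=
    Integrable.of_bound (hg.comp measurable_snd).aestronglyMeasurable C
      (ae_of_all _ fun q => by simpa only [Real.norm_eq_abs] using hC q.2)
  rw [Measure.integral_compProd hi2, Measure.integral_compProd hi1]
  refine integral_congr_ae (ae_of_all _ fun x => ?_)
  show ∫ y, g y.2 ∂((κF ×ₖ κF') x) = ∫ y, g y ∂(κF' x)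
  rw [Kernel.prod_apply]
  have h := integral_prod_mul (μ := κF x) (ν := κF' x) (f := fun _ : E => (1 : ℝ)) (g := g)
  simp only [mul_one, one_mul, integral_const, smul_eq_mul, probReal_univ] at h
  exact h

omit [IsFiniteMeasure ν₀] [IsFiniteMeasure ν₁] [IsMarkovKernel κ₀] in
/-- **THE PAIRED DIFFERENCE OF JARZYNSKI WEIGHTS HAS TARGET MEAN ZERO, WHATEVER THE TWO PROTOCOLS.**
Two Crooks pairs between the same `ν₀ → ν₁`, work floors, `π₀ = Z₀⁻¹ ν₀`:
`∫ (e^{−W(ω)} − e^{−W'(ω')}) d(π₀ ⊗ₘ (κF ×ₖ κF')) = 0`. -/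
theorem restart_pairedWeights_mean_zero
    (h : CrooksPair ν₀ ν₁ κF κR s e W) (h' : CrooksPair ν₀ ν₁ κF' κR' s' e' W')
    (hπ₀ : π₀ = (ν₀ univ)⁻¹ • ν₀)
    {Wlo : ℝ} (hlo : ∀ ω, Wlo ≤ W ω) {Wlo' : ℝ} (hlo' : ∀ ω, Wlo' ≤ W' ω) :
    ∫ p, (Real.exp (-W p.2.1) - Real.exp (-W' p.2.2)) ∂(π₀ ⊗ₘ (κF ×ₖ κF')) = 0 := by
  have hg : Measurable fun ω : E => Real.exp (-W ω) := Real.measurable_exp.comp h.measurable_W.neg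
  have hg' : Measurable fun ω : E' => Real.exp (-W' ω) :=
    Real.measurable_exp.comp h'.measurable_W.neg
  have hC : ∀ ω : E, |Real.exp (-W ω)| ≤ Real.exp (-Wlo) := fun ω => by
    rw [abs_of_pos (Real.exp_pos _)]; exact Real.exp_le_exp.2 (neg_le_neg (hlo ω))
  have hC' : ∀ ω : E', |Real.exp (-W' ω)| ≤ Real.exp (-Wlo') := fun ω => by
    rw [abs_of_pos (Real.exp_pos _)]; exact Real.exp_le_exp.2 (neg_le_neg (hlo' ω))
  have hi : Integrable (fun p : Ω × (E × E') => Real.exp (-W p.2.1)) (π₀ ⊗ₘ (κF ×ₖ κF')) :=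
    Integrable.of_bound (hg.comp (measurable_fst.comp measurable_snd)).aestronglyMeasurable
      (Real.exp (-Wlo)) (ae_of_all _ fun p => by simpa only [Real.norm_eq_abs] using hC p.2.1)
  have hi' : Integrable (fun p : Ω × (E × E') => Real.exp (-W' p.2.2)) (π₀ ⊗ₘ (κF ×ₖ κF')) :=
    Integrable.of_bound (hg'.comp (measurable_snd.comp measurable_snd)).aestronglyMeasurable
      (Real.exp (-Wlo')) (ae_of_all _ fun p => by simpa only [Real.norm_eq_abs] using hC' p.2.2)
  rw [integral_sub hi hi', integral_fst_restartPair (κF := κF) (κF' := κF') hg hC,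
    integral_snd_restartPair (κF := κF) (κF' := κF') hg' hC', restart_jarzynski_mean h hπ₀,
    restart_jarzynski_mean h' hπ₀, sub_self]

omit [IsFiniteMeasure ν₀] [IsFiniteMeasure ν₁] in
/-- **THE PAIRED TWO-PROTOCOL TEST IS ASYMPTOTICALLY STANDARD NORMAL, FROM EVERY START.**  Two
Crooks pairs between the same `ν₀ → ν₁` launched from the same prior chain `κ₀` (`π₀ = Z₀⁻¹ ν₀`
invariant, `κ₀(x, ·) ≥ ε π₀`, `ε > 0`), work floors, `σ²_D > 0` for the difference of weights
`D = e^{−W(ω)} − e^{−W'(ω')}` along the joint restart chain, `a_n, b_n → ∞`, `N_n = b_n a_n`; for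
`Y ~ N(0, 1)`: `((√N_n)⁻¹ Σ_{t<N_n} D_t) / √(σ̂²_{D,n}) ⇒ Y` under `P_{μ₀}` — the paired z-statistic
`(Ḡ_N − Ḡ'_N)/(σ̂_{D,n}/√N_n)` with the batch-means bar of the differences. -/
theorem restart_jarzynski_pairedProtocol_agreement_clt
    (h : CrooksPair ν₀ ν₁ κF κR s e W) (h' : CrooksPair ν₀ ν₁ κF' κR' s' e' W')
    (hπ₀ : π₀ = (ν₀ univ)⁻¹ • ν₀) (hinv : Kernel.Invariant κ₀ π₀)
    (hmin : ∀ x {B : Set Ω}, MeasurableSet B → ε * π₀ B ≤ κ₀ x B) (hε0 : 0 < ε)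
    {Wlo : ℝ} (hlo : ∀ ω, Wlo ≤ W ω) {Wlo' : ℝ} (hlo' : ∀ ω, Wlo' ≤ W' ω)
    (hσ : 0 < ((∫ p, (Real.exp (-W p.2.1) - Real.exp (-W' p.2.2)) ^ 2 ∂(π₀ ⊗ₘ (κF ×ₖ κF')))
          + 2 * ∑' k, ∫ p, (Real.exp (-W p.2.1) - Real.exp (-W' p.2.2))
            * (kop ((Kernel.prodMkRight (E × E') κ₀)
                ⊗ₖ (Kernel.prodMkLeft (Ω × (E × E')) (κF ×ₖ κF'))))^[k + 1]
              (fun p => Real.exp (-W p.2.1) - Real.exp (-W' p.2.2)) p ∂(π₀ ⊗ₘ (κF ×ₖ κF'))))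
    (μ₀ : Measure (Ω × (E × E'))) [IsProbabilityMeasure μ₀] {a b : ℕ → ℕ}
    (ha : Tendsto a atTop atTop) (hb : Tendsto b atTop atTop)
    {Ω' : Type*} [MeasurableSpace Ω'] {P' : Measure Ω'} [IsProbabilityMeasure P'] {Y : Ω' → ℝ}
    (hY : HasLaw Y (gaussianReal 0 1) P')
    [IsProbabilityMeasure (Kernel.trajMeasure (X := fun _ : ℕ => Ω × (E × E')) μ₀
          (fun n : ℕ => ((Kernel.prodMkRight (E × E') κ₀)
              ⊗ₖ (Kernel.prodMkLeft (Ω × (E × E')) (κF ×ₖ κF'))).comap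
            (fun h : (i : ↥(Finset.Iic n)) → Ω × (E × E') => h ⟨n, Finset.mem_Iic.2 le_rfl⟩)
            (measurable_pi_apply _)))] :
    TendstoInDistribution (fun (n : ℕ) (x : ℕ → Ω × (E × E')) =>
        ((Real.sqrt ((b n * a n : ℕ) : ℝ))⁻¹
          * ∑ t ∈ Finset.range (b n * a n),
              (Real.exp (-W (x t).2.1) - Real.exp (-W' (x t).2.2)))
        / Real.sqrt (((b n * a n : ℕ) : ℝ)
          * replicaSEsq (fun j (x : ℕ → Ω × (E × E')) =>
              (∑ i ∈ Finset.range (b n),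
                (Real.exp (-W (x (b n * j + i)).2.1) - Real.exp (-W' (x (b n * j + i)).2.2)))
              / (b n)) (a n) x))
      atTop Y (fun _ => (Kernel.trajMeasure (X := fun _ : ℕ => Ω × (E × E')) μ₀
          (fun n : ℕ => ((Kernel.prodMkRight (E × E') κ₀)
              ⊗ₖ (Kernel.prodMkLeft (Ω × (E × E')) (κF ×ₖ κF'))).comap
            (fun h : (i : ↥(Finset.Iic n)) → Ω × (E × E') => h ⟨n, Finset.mem_Iic.2 le_rfl⟩)
            (measurable_pi_apply _)))) P' := by
  -- the joint restart chain is minorised in ONE step by its invariant law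
  have hmin1 : ∀ z, ε • (π₀ ⊗ₘ (κF ×ₖ κF')) ≤ nHit ((Kernel.prodMkRight (E × E') κ₀)
      ⊗ₖ (Kernel.prodMkLeft (Ω × (E × E')) (κF ×ₖ κF'))) 1 z := fun z => by
    rw [nHit_one]
    refine Measure.le_iff.2 fun B hB => ?_
    rw [Measure.smul_apply, smul_eq_mul]
    exact restart_doeblin (κF := κF ×ₖ κF') hmin z hB
  haveI : Nonempty (Ω × (E × E')) := nonempty_of_isProbabilityMeasure μ₀
  have hε1 : ε ≤ 1 := by
    haveI := isMarkovKernel_nHit ((Kernel.prodMkRight (E × E') κ₀)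
      ⊗ₖ (Kernel.prodMkLeft (Ω × (E × E')) (κF ×ₖ κF'))) 1
    exact eps_le_one_of_minorised hmin1
  -- the difference of weights: bounded, measurable, target mean ZERO
  have hf : Measurable fun p : Ω × (E × E') => Real.exp (-W p.2.1) - Real.exp (-W' p.2.2) :=
    (Real.measurable_exp.comp (h.measurable_W.comp (measurable_fst.comp measurable_snd)).neg).sub
      (Real.measurable_exp.comp (h'.measurable_W.comp (measurable_snd.comp measurable_snd)).neg)
  have hC : ∀ p : Ω × (E × E'), |Real.exp (-W p.2.1) - Real.exp (-W' p.2.2)|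
      ≤ Real.exp (-Wlo) + Real.exp (-Wlo') := fun p => by
    have h1 : |Real.exp (-W p.2.1)| ≤ Real.exp (-Wlo) := by
      rw [abs_of_pos (Real.exp_pos _)]; exact Real.exp_le_exp.2 (neg_le_neg (hlo p.2.1))
    have h2 : |Real.exp (-W' p.2.2)| ≤ Real.exp (-Wlo') := by
      rw [abs_of_pos (Real.exp_pos _)]; exact Real.exp_le_exp.2 (neg_le_neg (hlo' p.2.2))
    exact (abs_sub _ _).trans (add_le_add h1 h2)
  have h0 := restart_pairedWeights_mean_zero (κF := κF) (κF' := κF') h h' hπ₀ hlo hlo'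
  have key := doeblinPower_batchMeans_studentized_clt (invariant_restart hinv) hmin1 hε0 hε1 one_pos
    hf hC (by rw [h0]; simpa only [sub_zero] using hσ) μ₀ ha hb hY
  rw [h0] at key
  simpa only [sub_zero] using key

omit [IsFiniteMeasure ν₀] [IsFiniteMeasure ν₁] in
/-- **THE PAIRED TWO-PROTOCOL TEST IS CALIBRATED.**  Under the hypotheses of
`restart_jarzynski_pairedProtocol_agreement_clt`, for every `z > 0`:
`P_{μ₀} {|((√N_n)⁻¹ Σ_{t<N_n} D_t) / √(σ̂²_{D,n})| ≤ z} → (gaussianReal 0 1)[−z, z]`. -/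
theorem restart_jarzynski_pairedProtocol_agreement_coverage
    (h : CrooksPair ν₀ ν₁ κF κR s e W) (h' : CrooksPair ν₀ ν₁ κF' κR' s' e' W')
    (hπ₀ : π₀ = (ν₀ univ)⁻¹ • ν₀) (hinv : Kernel.Invariant κ₀ π₀)
    (hmin : ∀ x {B : Set Ω}, MeasurableSet B → ε * π₀ B ≤ κ₀ x B) (hε0 : 0 < ε)
    {Wlo : ℝ} (hlo : ∀ ω, Wlo ≤ W ω) {Wlo' : ℝ} (hlo' : ∀ ω, Wlo' ≤ W' ω)
    (hσ : 0 < ((∫ p, (Real.exp (-W p.2.1) - Real.exp (-W' p.2.2)) ^ 2 ∂(π₀ ⊗ₘ (κF ×ₖ κF')))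
          + 2 * ∑' k, ∫ p, (Real.exp (-W p.2.1) - Real.exp (-W' p.2.2))
            * (kop ((Kernel.prodMkRight (E × E') κ₀)
                ⊗ₖ (Kernel.prodMkLeft (Ω × (E × E')) (κF ×ₖ κF'))))^[k + 1]
              (fun p => Real.exp (-W p.2.1) - Real.exp (-W' p.2.2)) p ∂(π₀ ⊗ₘ (κF ×ₖ κF'))))
    (μ₀ : Measure (Ω × (E × E'))) [IsProbabilityMeasure μ₀] {a b : ℕ → ℕ}
    (ha : Tendsto a atTop atTop) (hb : Tendsto b atTop atTop) {z : ℝ} (hz : 0 < z)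
    [IsProbabilityMeasure (Kernel.trajMeasure (X := fun _ : ℕ => Ω × (E × E')) μ₀
          (fun n : ℕ => ((Kernel.prodMkRight (E × E') κ₀)
              ⊗ₖ (Kernel.prodMkLeft (Ω × (E × E')) (κF ×ₖ κF'))).comap
            (fun h : (i : ↥(Finset.Iic n)) → Ω × (E × E') => h ⟨n, Finset.mem_Iic.2 le_rfl⟩)
            (measurable_pi_apply _)))] :
    Tendsto (fun n : ℕ => (Kernel.trajMeasure (X := fun _ : ℕ => Ω × (E × E')) μ₀
          (fun n : ℕ => ((Kernel.prodMkRight (E × E') κ₀)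
              ⊗ₖ (Kernel.prodMkLeft (Ω × (E × E')) (κF ×ₖ κF'))).comap
            (fun h : (i : ↥(Finset.Iic n)) → Ω × (E × E') => h ⟨n, Finset.mem_Iic.2 le_rfl⟩)
            (measurable_pi_apply _))).real
      {x | |((Real.sqrt ((b n * a n : ℕ) : ℝ))⁻¹
          * ∑ t ∈ Finset.range (b n * a n),
              (Real.exp (-W (x t).2.1) - Real.exp (-W' (x t).2.2)))
        / Real.sqrt (((b n * a n : ℕ) : ℝ)
          * replicaSEsq (fun j (x : ℕ → Ω × (E × E')) =>
              (∑ i ∈ Finset.range (b n),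
                (Real.exp (-W (x (b n * j + i)).2.1) - Real.exp (-W' (x (b n * j + i)).2.2)))
              / (b n)) (a n) x)| ≤ z})
      atTop (𝓝 ((gaussianReal 0 1).real (Set.Icc (-z) z))) := by
  have hmin1 : ∀ z, ε • (π₀ ⊗ₘ (κF ×ₖ κF')) ≤ nHit ((Kernel.prodMkRight (E × E') κ₀)
      ⊗ₖ (Kernel.prodMkLeft (Ω × (E × E')) (κF ×ₖ κF'))) 1 z := fun z => by
    rw [nHit_one]
    refine Measure.le_iff.2 fun B hB => ?_
    rw [Measure.smul_apply, smul_eq_mul]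
    exact restart_doeblin (κF := κF ×ₖ κF') hmin z hB
  haveI : Nonempty (Ω × (E × E')) := nonempty_of_isProbabilityMeasure μ₀
  have hε1 : ε ≤ 1 := by
    haveI := isMarkovKernel_nHit ((Kernel.prodMkRight (E × E') κ₀)
      ⊗ₖ (Kernel.prodMkLeft (Ω × (E × E')) (κF ×ₖ κF'))) 1
    exact eps_le_one_of_minorised hmin1
  have hf : Measurable fun p : Ω × (E × E') => Real.exp (-W p.2.1) - Real.exp (-W' p.2.2) :=
    (Real.measurable_exp.comp (h.measurable_W.comp (measurable_fst.comp measurable_snd)).neg).sub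
      (Real.measurable_exp.comp (h'.measurable_W.comp (measurable_snd.comp measurable_snd)).neg)
  have hC : ∀ p : Ω × (E × E'), |Real.exp (-W p.2.1) - Real.exp (-W' p.2.2)|
      ≤ Real.exp (-Wlo) + Real.exp (-Wlo') := fun p => by
    have h1 : |Real.exp (-W p.2.1)| ≤ Real.exp (-Wlo) := by
      rw [abs_of_pos (Real.exp_pos _)]; exact Real.exp_le_exp.2 (neg_le_neg (hlo p.2.1))
    have h2 : |Real.exp (-W' p.2.2)| ≤ Real.exp (-Wlo') := by
      rw [abs_of_pos (Real.exp_pos _)]; exact Real.exp_le_exp.2 (neg_le_neg (hlo' p.2.2))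
    exact (abs_sub _ _).trans (add_le_add h1 h2)
  have h0 := restart_pairedWeights_mean_zero (κF := κF) (κF' := κF') h h' hπ₀ hlo hlo'
  have key := doeblinPower_batchMeans_studentized_coverage (invariant_restart hinv) hmin1 hε0 hε1
    one_pos hf hC (by rw [h0]; simpa only [sub_zero] using hσ) μ₀ ha hb hz
  rw [h0] at key
  simpa only [sub_zero] using key

end Paired

end Summit.Ventures.LatticeQCDFlow.Scoring

end
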